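import Summits.HodgeConjecture.HodgeConjecture.Theorems.VHCAbelianSchemesRoadLocusEngineTail
import Summits.HodgeConjecture.HodgeConjecture.Theses.VHCAbelianSchemesRoad
import HarnessLib

/-!
# Road №4 (`VHCAbelianSchemesRoad`) — «no load-bearing cell» stated ON THE ROUTE DECLS (rev 27): the leaf `HC_AV` from the binders
# of `closes` with the LOCAL crux `SemiregularSheafRepresentativesTwPrimeAtDiagLocal` replaced by ANY TAIL ∕ ANY INFINITE SET of its
# diagonal cells, and the GLUED shape over the displayed print input `MarkmanPinnedForallTwPrime`

research route conditional on HC_CM; not a corollary; Q11.4-sentence-2 already refuted in dim ≥ 3.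

THEOREMS ONLY (no definition, no named fact, no sorry; nothing of the road's research content is claimed; `HC_CM` occurs nowhere).
Seat core-w8 gen 0 (width copy of core-D; director-hodge g16 R16.9 plate «stub (1′)»: census HOME INBOX l.5582, kernel half
`VHCAbelianSchemesRoadLocusEngineTail.lean` p648782). This CLOSER-type companion imports the ROUTE FILE and restates the tail heads
with hypotheses LITERALLY the route decls of `Theses.VHCAbelianSchemesRoad` — in the pattern of ab-andre-2's
`VHCAbelianSchemesRoadDiagonalTailItems.lean` for the earlier crux `SemiregularSheafRepresentativesTwAt` — so that a planner re-keying
the crux to a tail reads the new `closes` off this file. `--supports stmt-HodgeConjecture-26512 --as helper`; closes NO stub or item;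
the route file, its `closes` glue, the binders of record and the skeleton are NOT touched.

* §1 C → S bookkeeping: the crux of record (item 23176) ⟹ every tail `m ≥ M₀` (`M₀ ≥ 2`) ⟹ «infinitely many cells»; the same
  under the displayed print input for the live child (item 26512 `DiagLocalOfMarkmanPinnedForall`).
* §2 `hc_av_of_twPrimeAtDiagLocal_ge` — `HC_AV` from `ChernCharacterOnBetti`, ANY TAIL `∀ C m, M₀ ≤ m → LefAtExceptionalRegimeAtLocal
  (tw C AdmTw′) (2m) m`, `TwistedPerfectDoorPrime`, `RaynaudSectionProjective`, `AndreCMAnchoredPencil`, `AndreAnchoredPencilsAlgebraic`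
  — EVERY `M₀`, FACT-FREE; `_three` (the cell `(4, 2)` = stub 1′ struck), `_four` (the tail stub 3′ᴸ alone), `_frequently`; and
  `closes_of_twPrimeAtDiagLocal` (sanity: at `M₀ = 2` this is the deciding theorem `closes` verbatim).
* §3 the GLUED shape of items 26511 ∕ 26512 ∕ 26513: `hc_av_of_markmanPinnedForall_of_diagLocalTail` — `MarkmanPinnedForallTwPrime →
  (MarkmanPinnedForallTwPrime → tail m ≥ M₀) → TwistedPerfectDoorPrime → … → HC_AV`, every `M₀`: a child crux re-keyed to the
  tail `m ≥ 3` (stub 1′ struck) glues to the leaf exactly as `DiagLocalOfMarkmanPinnedForall` does.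

References: [Andre1996Motifs] §6.3; [BrosnanFangNiePearlstein2009] §6 Lemma 48; [Fulton1998] §10.1; [Pridham2024Semiregularity]
Cor. 2.25, Rem. 2.26; [BuchweitzFlenner2003] §5 Thm. 5.1; [Markman2025SecantWeil] Thm. 1.4.1, Thm. 1.5.1.
-/

noncomputable section

open CategoryTheory CategoryTheory.Limits AlgebraicGeometry Topology

namespace Summit.HodgeConjecture.HodgeConjecture.Ring2.SemiregularRepresentatives

set_option linter.dupNamespace false -- the cell's namespace repeats the summit name, as in every `Ring2*` file

open Literature.AlgebraicGeometry Literature.AlgebraicGeometry.Motives Literature.AlgebraicGeometry.HodgeTheory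
open Literature.AlgebraicTopology.SingularHomology

/-! ## §1 C → S bookkeeping on the route decls -/

/-- **The LOCAL crux of record (item 23176, BY NAME) implies every tail `m ≥ M₀` of its diagonal slice** (`M₀ ≥ 2`; a re-key to a tail
is a pure WEAKENING). [folklore] -/
theorem twPrimeAtDiagLocal_ge_of_crux (h : Theses.VHCAbelianSchemesRoad.SemiregularSheafRepresentativesTwPrimeAtDiagLocal)
    {M₀ : ℕ} (hM₀ : 2 ≤ M₀) :
    ∀ (C : ChernCharacterBetti) (m : ℕ), M₀ ≤ m →
      LefAtExceptionalRegimeAtLocal (twistedReflexiveClass C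
        (fun n X₀ I E => Summit.Ventures.HSemireg.gluableSigmaAdmissible n X₀ I E ∨ bfSingleAdmissible' n X₀ I E)) (2 * m) m :=
  fun C m hm => h C m (le_trans hM₀ hm)

/-- **Every tail is an infinite set of cells** (per Chern character theory). [folklore] -/
theorem twPrimeAtDiagLocal_frequently_of_ge {M₀ : ℕ}
    (h : ∀ (C : ChernCharacterBetti) (m : ℕ), M₀ ≤ m →
      LefAtExceptionalRegimeAtLocal (twistedReflexiveClass C
        (fun n X₀ I E => Summit.Ventures.HSemireg.gluableSigmaAdmissible n X₀ I E ∨ bfSingleAdmissible' n X₀ I E)) (2 * m) m) :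
    ∀ (C : ChernCharacterBetti) (M : ℕ), ∃ m : ℕ, M ≤ m ∧
      LefAtExceptionalRegimeAtLocal (twistedReflexiveClass C
        (fun n X₀ I E => Summit.Ventures.HSemireg.gluableSigmaAdmissible n X₀ I E ∨ bfSingleAdmissible' n X₀ I E)) (2 * m) m :=
  fun C M => ⟨max M M₀, le_max_left _ _, h C _ (le_max_right _ _)⟩

/-- **The live child crux (item 26512 `DiagLocalOfMarkmanPinnedForall`, BY NAME) implies, under the displayed print input
`MarkmanPinnedForallTwPrime` (item 26511), every tail `m ≥ M₀` (`M₀ ≥ 2`).** [folklore] -/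
theorem twPrimeAtDiagLocal_ge_of_diagLocalOfMarkmanPinnedForall
    (h : Theses.VHCAbelianSchemesRoad.DiagLocalOfMarkmanPinnedForall) (hL : Theses.VHCAbelianSchemesRoad.MarkmanPinnedForallTwPrime)
    {M₀ : ℕ} (hM₀ : 2 ≤ M₀) :
    ∀ (C : ChernCharacterBetti) (m : ℕ), M₀ ≤ m →
      LefAtExceptionalRegimeAtLocal (twistedReflexiveClass C
        (fun n X₀ I E => Summit.Ventures.HSemireg.gluableSigmaAdmissible n X₀ I E ∨ bfSingleAdmissible' n X₀ I E)) (2 * m) m :=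
  twPrimeAtDiagLocal_ge_of_crux (h hL) hM₀

/-! ## §2 `HC_AV` from the binders of `closes` with the crux replaced by ANY TAIL ∕ INFINITELY MANY cells of its diagonal -/

/-- **`HC_AV` from the five other binders of `Theses.VHCAbelianSchemesRoad.closes` (rev 27) with the LOCAL crux
`SemiregularSheafRepresentativesTwPrimeAtDiagLocal` (item 23176) replaced by ANY TAIL `m ≥ M₀` of its diagonal slice** — EVERY `M₀`,
FACT-FREE beyond the displayed route decls (`ChernCharacterOnBetti`, `TwistedPerfectDoorPrime`, `RaynaudSectionProjective`,
`AndreCMAnchoredPencil`, `AndreAnchoredPencilsAlgebraic`); no `HCUpToDim 5`, no `HC_CM`. In the crux as filed («every diagonal cell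
`m ≥ 2`») NO SINGLE CELL — neither `(4, 2)` = stub 1′ nor the rung `(6, 3)` — is load-bearing for the leaf.
[cite: Andre1996Motifs, §6.3 Lemmes 6.3.1–6.3.3] [cite: BrosnanFangNiePearlstein2009, §6 Lemma 48] [cite: Fulton1998, §10.1 Cor. 10.1]
[cite: Pridham2024Semiregularity, Rem. 2.26 with Cor. 2.25] [cite: BuchweitzFlenner2003, §5 Thm. 5.1] -/
theorem hc_av_of_twPrimeAtDiagLocal_ge (hC : Theses.VHCAbelianSchemesRoad.ChernCharacterOnBetti) (M₀ : ℕ)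
    (hTail : ∀ (C : ChernCharacterBetti) (m : ℕ), M₀ ≤ m →
      LefAtExceptionalRegimeAtLocal (twistedReflexiveClass C
        (fun n X₀ I E => Summit.Ventures.HSemireg.gluableSigmaAdmissible n X₀ I E ∨ bfSingleAdmissible' n X₀ I E)) (2 * m) m)
    (hDoor : Theses.VHCAbelianSchemesRoad.TwistedPerfectDoorPrime) (hR : Theses.VHCAbelianSchemesRoad.RaynaudSectionProjective)
    (h₂₁ : Theses.VHCAbelianSchemesRoad.AndreCMAnchoredPencil) (h₂₂ : Theses.VHCAbelianSchemesRoad.AndreAnchoredPencilsAlgebraic) :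
    Theses.PadicSemiregularLift.HodgeAbelianVarieties :=
  hc_av_of_exceptionalRegimeAtLocal_admTw'_diagonal_ge hC M₀ hTail hDoor hR h₂₁ h₂₂

/-- **Sanity: at `M₀ = 2` the tail head IS the deciding theorem** — `closes` of rev 27, re-derived through the tail engine (the binders
of record unfold to the carrier's constants definitionally). [folklore] -/
theorem closes_of_twPrimeAtDiagLocal (hC : Theses.VHCAbelianSchemesRoad.ChernCharacterOnBetti)
    (hDiagLoc : Theses.VHCAbelianSchemesRoad.SemiregularSheafRepresentativesTwPrimeAtDiagLocal)
    (hDoor : Theses.VHCAbelianSchemesRoad.TwistedPerfectDoorPrime) (hR : Theses.VHCAbelianSchemesRoad.RaynaudSectionProjective)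
    (h₂₁ : Theses.VHCAbelianSchemesRoad.AndreCMAnchoredPencil) (h₂₂ : Theses.VHCAbelianSchemesRoad.AndreAnchoredPencilsAlgebraic) :
    Theses.PadicSemiregularLift.HodgeAbelianVarieties :=
  hc_av_of_twPrimeAtDiagLocal_ge hC 2 hDiagLoc hDoor hR h₂₁ h₂₂

/-- **Repair path (β′) of the route file IN LOCAL FORM, on the route decls, fact-free**: `HC_AV` from `ChernCharacterOnBetti`, LOCAL regime
2 on the diagonal from `(6, 3)` on (the crux with the cell `(4, 2)` = stub 1′ STRUCK), `TwistedPerfectDoorPrime`, Raynaud, André #21/#22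
— no `HCUpToDim 5`. [cite: Andre1996Motifs, §6.3 Lemmes 6.3.1–6.3.3] [cite: BrosnanFangNiePearlstein2009, §6 Lemma 48]
[cite: Fulton1998, §10.1 Cor. 10.1] -/
theorem hc_av_of_twPrimeAtDiagLocal_three (hC : Theses.VHCAbelianSchemesRoad.ChernCharacterOnBetti)
    (hTail : ∀ (C : ChernCharacterBetti) (m : ℕ), 3 ≤ m →
      LefAtExceptionalRegimeAtLocal (twistedReflexiveClass C
        (fun n X₀ I E => Summit.Ventures.HSemireg.gluableSigmaAdmissible n X₀ I E ∨ bfSingleAdmissible' n X₀ I E)) (2 * m) m)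
    (hDoor : Theses.VHCAbelianSchemesRoad.TwistedPerfectDoorPrime) (hR : Theses.VHCAbelianSchemesRoad.RaynaudSectionProjective)
    (h₂₁ : Theses.VHCAbelianSchemesRoad.AndreCMAnchoredPencil) (h₂₂ : Theses.VHCAbelianSchemesRoad.AndreAnchoredPencilsAlgebraic) :
    Theses.PadicSemiregularLift.HodgeAbelianVarieties :=
  hc_av_of_twPrimeAtDiagLocal_ge hC 3 hTail hDoor hR h₂₁ h₂₂

/-- **The TAIL STUB 3′ᴸ ALONE** (`stub_diagonalTailTwPrimeLocal : ∀ C m, 4 ≤ m → LefAtExceptionalRegimeAtLocal (tw C AdmTw′) (2m) m` of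
skeleton v3.12b) **with the five other binders of `closes` gives `HC_AV`** — the cells `(4, 2)` and `(6, 3)` are not load-bearing.
[cite: Andre1996Motifs, §6.3 Lemmes 6.3.1–6.3.3] [cite: BrosnanFangNiePearlstein2009, §6 Lemma 48] [cite: Fulton1998, §10.1 Cor. 10.1] -/
theorem hc_av_of_twPrimeAtDiagLocal_four (hC : Theses.VHCAbelianSchemesRoad.ChernCharacterOnBetti)
    (hTail : ∀ (C : ChernCharacterBetti) (m : ℕ), 4 ≤ m →
      LefAtExceptionalRegimeAtLocal (twistedReflexiveClass C
        (fun n X₀ I E => Summit.Ventures.HSemireg.gluableSigmaAdmissible n X₀ I E ∨ bfSingleAdmissible' n X₀ I E)) (2 * m) m)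
    (hDoor : Theses.VHCAbelianSchemesRoad.TwistedPerfectDoorPrime) (hR : Theses.VHCAbelianSchemesRoad.RaynaudSectionProjective)
    (h₂₁ : Theses.VHCAbelianSchemesRoad.AndreCMAnchoredPencil) (h₂₂ : Theses.VHCAbelianSchemesRoad.AndreAnchoredPencilsAlgebraic) :
    Theses.PadicSemiregularLift.HodgeAbelianVarieties :=
  hc_av_of_twPrimeAtDiagLocal_ge hC 4 hTail hDoor hR h₂₁ h₂₂

/-- **The weakest form on the route decls**: `HC_AV` from LOCAL regime 2 at INFINITELY MANY diagonal cells (per Chern character theory)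
and the five other binders of `closes` — FACT-FREE. [cite: Andre1996Motifs, §6.3 Lemmes 6.3.1–6.3.3]
[cite: BrosnanFangNiePearlstein2009, §6 Lemma 48] [cite: Fulton1998, §10.1 Cor. 10.1] -/
theorem hc_av_of_twPrimeAtDiagLocal_frequently (hC : Theses.VHCAbelianSchemesRoad.ChernCharacterOnBetti)
    (hFreq : ∀ (C : ChernCharacterBetti) (M : ℕ), ∃ m : ℕ, M ≤ m ∧
      LefAtExceptionalRegimeAtLocal (twistedReflexiveClass C
        (fun n X₀ I E => Summit.Ventures.HSemireg.gluableSigmaAdmissible n X₀ I E ∨ bfSingleAdmissible' n X₀ I E)) (2 * m) m)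
    (hDoor : Theses.VHCAbelianSchemesRoad.TwistedPerfectDoorPrime) (hR : Theses.VHCAbelianSchemesRoad.RaynaudSectionProjective)
    (h₂₁ : Theses.VHCAbelianSchemesRoad.AndreCMAnchoredPencil) (h₂₂ : Theses.VHCAbelianSchemesRoad.AndreAnchoredPencilsAlgebraic) :
    Theses.PadicSemiregularLift.HodgeAbelianVarieties :=
  hc_av_of_exceptionalRegimeAtLocal_admTw'_diagonal_frequently hC hFreq hDoor hR h₂₁ h₂₂

/-! ## §3 The GLUED shape of items 26511 ∕ 26512 ∕ 26513 with a tail crux -/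

/-- **The glue of record with the child crux re-keyed to a tail**: `MarkmanPinnedForallTwPrime` (item 26511, displayed print input) and a
child «`MarkmanPinnedForallTwPrime →` LOCAL regime 2 at every diagonal cell `m ≥ M₀`» (the shape of item 26512 with its slice cut to a
tail — e.g. `M₀ = 3`, stub 1′ struck) give, with the four other binders of `closes`, the leaf `HC_AV` — every `M₀`, FACT-FREE; the
modus ponens of item 26513 `SemiregularSheafRepresentativesTwPrimeAtDiagLocalGlue` composed with §2.
[cite: Markman2025SecantWeil, Thm. 1.4.1 and Thm. 1.5.1] [cite: Andre1996Motifs, §6.3 Lemmes 6.3.1–6.3.3]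
[cite: BrosnanFangNiePearlstein2009, §6 Lemma 48] [cite: Fulton1998, §10.1 Cor. 10.1] -/
theorem hc_av_of_markmanPinnedForall_of_diagLocalTail (hC : Theses.VHCAbelianSchemesRoad.ChernCharacterOnBetti) (M₀ : ℕ)
    (hL : Theses.VHCAbelianSchemesRoad.MarkmanPinnedForallTwPrime)
    (hChild : Theses.VHCAbelianSchemesRoad.MarkmanPinnedForallTwPrime →
      ∀ (C : ChernCharacterBetti) (m : ℕ), M₀ ≤ m →
        LefAtExceptionalRegimeAtLocal (twistedReflexiveClass C
          (fun n X₀ I E => Summit.Ventures.HSemireg.gluableSigmaAdmissible n X₀ I E ∨ bfSingleAdmissible' n X₀ I E)) (2 * m) m)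
    (hDoor : Theses.VHCAbelianSchemesRoad.TwistedPerfectDoorPrime) (hR : Theses.VHCAbelianSchemesRoad.RaynaudSectionProjective)
    (h₂₁ : Theses.VHCAbelianSchemesRoad.AndreCMAnchoredPencil) (h₂₂ : Theses.VHCAbelianSchemesRoad.AndreAnchoredPencilsAlgebraic) :
    Theses.PadicSemiregularLift.HodgeAbelianVarieties :=
  hc_av_of_twPrimeAtDiagLocal_ge hC M₀ (hChild hL) hDoor hR h₂₁ h₂₂

/-- **The items of record glue through the tail engine** (sanity, `M₀ = 2`): items 26511 and 26512 BY NAME, with the four other binders,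
give `HC_AV` — the composite of item 26513's modus ponens and `closes`. [folklore] -/
theorem hc_av_of_markmanPinnedForall_of_diagLocalOfMarkmanPinnedForall (hC : Theses.VHCAbelianSchemesRoad.ChernCharacterOnBetti)
    (hL : Theses.VHCAbelianSchemesRoad.MarkmanPinnedForallTwPrime) (hChild : Theses.VHCAbelianSchemesRoad.DiagLocalOfMarkmanPinnedForall)
    (hDoor : Theses.VHCAbelianSchemesRoad.TwistedPerfectDoorPrime) (hR : Theses.VHCAbelianSchemesRoad.RaynaudSectionProjective)
    (h₂₁ : Theses.VHCAbelianSchemesRoad.AndreCMAnchoredPencil) (h₂₂ : Theses.VHCAbelianSchemesRoad.AndreAnchoredPencilsAlgebraic) :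
    Theses.PadicSemiregularLift.HodgeAbelianVarieties :=
  hc_av_of_markmanPinnedForall_of_diagLocalTail hC 2 hL (fun h => twPrimeAtDiagLocal_ge_of_diagLocalOfMarkmanPinnedForall hChild h le_rfl)
    hDoor hR h₂₁ h₂₂

/-! ## §4 The skeleton composition WITHOUT the first cell (appended; for a re-key of item 26512 to the tail `m ≥ 3`) -/

/-- **BC3 composition from `(6, 3)` on, hypothesis form (local)**: the `(6, 3)` cell in local form and the tail `m ≥ 4` (the statements
of skeleton v3.12b's `localCell_sixfoldMiddleOffHypDisjEndTwPrime_of_cells` and `stub_diagonalTailTwPrimeLocal`) give the LOCAL diagonal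
slice from `m ≥ 3` — v3.12b's `twPrimeAtDiagLocal_of_cells` with its first hypothesis (stub 1′, the cell `(4, 2)`) STRUCK. [folklore] -/
theorem twPrimeAtDiagLocalTail_of_cells
    (h₂ : ∀ C : ChernCharacterBetti,
      LefAtExceptionalRegimeAtLocal (twistedReflexiveClass C
        (fun n X₀ I E => Summit.Ventures.HSemireg.gluableSigmaAdmissible n X₀ I E ∨ bfSingleAdmissible' n X₀ I E)) 6 3)
    (h₃ : ∀ (C : ChernCharacterBetti) (m : ℕ), 4 ≤ m →
      LefAtExceptionalRegimeAtLocal (twistedReflexiveClass C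
        (fun n X₀ I E => Summit.Ventures.HSemireg.gluableSigmaAdmissible n X₀ I E ∨ bfSingleAdmissible' n X₀ I E)) (2 * m) m) :
    ∀ (C : ChernCharacterBetti) (m : ℕ), 3 ≤ m →
      LefAtExceptionalRegimeAtLocal (twistedReflexiveClass C
        (fun n X₀ I E => Summit.Ventures.HSemireg.gluableSigmaAdmissible n X₀ I E ∨ bfSingleAdmissible' n X₀ I E)) (2 * m) m := by
  intro C m hm
  rcases Nat.lt_or_ge m 4 with hlt | hge
  · obtain rfl : m = 3 := by omega
    exact h₂ C
  · exact h₃ C m hge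

/-- **The leaf from the `(6, 3)` cell, the tail `m ≥ 4` and the five other binders of `closes` — stub 1′ `(4, 2)` NOT used**, FACT-FREE
beyond the displayed route decls: the shape of `closes` for a child crux re-keyed to «LOCAL regime 2 at every diagonal cell `m ≥ 3`».
[cite: Andre1996Motifs, §6.3 Lemmes 6.3.1–6.3.3] [cite: BrosnanFangNiePearlstein2009, §6 Lemma 48] [cite: Fulton1998, §10.1 Cor. 10.1] -/
theorem hc_av_of_sixfoldCell_of_diagonalTail (hC : Theses.VHCAbelianSchemesRoad.ChernCharacterOnBetti)
    (h₂ : ∀ C : ChernCharacterBetti,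
      LefAtExceptionalRegimeAtLocal (twistedReflexiveClass C
        (fun n X₀ I E => Summit.Ventures.HSemireg.gluableSigmaAdmissible n X₀ I E ∨ bfSingleAdmissible' n X₀ I E)) 6 3)
    (h₃ : ∀ (C : ChernCharacterBetti) (m : ℕ), 4 ≤ m →
      LefAtExceptionalRegimeAtLocal (twistedReflexiveClass C
        (fun n X₀ I E => Summit.Ventures.HSemireg.gluableSigmaAdmissible n X₀ I E ∨ bfSingleAdmissible' n X₀ I E)) (2 * m) m)
    (hDoor : Theses.VHCAbelianSchemesRoad.TwistedPerfectDoorPrime) (hR : Theses.VHCAbelianSchemesRoad.RaynaudSectionProjective)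
    (h₂₁ : Theses.VHCAbelianSchemesRoad.AndreCMAnchoredPencil) (h₂₂ : Theses.VHCAbelianSchemesRoad.AndreAnchoredPencilsAlgebraic) :
    Theses.PadicSemiregularLift.HodgeAbelianVarieties :=
  hc_av_of_twPrimeAtDiagLocal_three hC (twPrimeAtDiagLocalTail_of_cells h₂ h₃) hDoor hR h₂₁ h₂₂

/-! ## §5 Sparse families of cells (appended): the leaf from the cells along ANY unbounded sequence, e.g. `(6k, 3k)` -/

/-- **`HC_AV` from LOCAL regime 2 along ANY UNBOUNDED SEQUENCE of diagonal cells `(2φ(k), φ(k))`** and the five other binders of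
`closes` — FACT-FREE (`hc_av_of_twPrimeAtDiagLocal_frequently`): the crux may be re-keyed to any convenient sparse family of cells.
[cite: Andre1996Motifs, §6.3 Lemmes 6.3.1–6.3.3] [cite: BrosnanFangNiePearlstein2009, §6 Lemma 48] [cite: Fulton1998, §10.1 Cor. 10.1] -/
theorem hc_av_of_twPrimeAtDiagLocal_along (hC : Theses.VHCAbelianSchemesRoad.ChernCharacterOnBetti) (φ : ℕ → ℕ)
    (hφ : ∀ M : ℕ, ∃ k : ℕ, M ≤ φ k)
    (hCells : ∀ (C : ChernCharacterBetti) (k : ℕ),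
      LefAtExceptionalRegimeAtLocal (twistedReflexiveClass C
        (fun n X₀ I E => Summit.Ventures.HSemireg.gluableSigmaAdmissible n X₀ I E ∨ bfSingleAdmissible' n X₀ I E)) (2 * φ k) (φ k))
    (hDoor : Theses.VHCAbelianSchemesRoad.TwistedPerfectDoorPrime) (hR : Theses.VHCAbelianSchemesRoad.RaynaudSectionProjective)
    (h₂₁ : Theses.VHCAbelianSchemesRoad.AndreCMAnchoredPencil) (h₂₂ : Theses.VHCAbelianSchemesRoad.AndreAnchoredPencilsAlgebraic) :
    Theses.PadicSemiregularLift.HodgeAbelianVarieties :=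
  hc_av_of_twPrimeAtDiagLocal_frequently hC
    (fun C M => by
      obtain ⟨k, hk⟩ := hφ M
      exact ⟨φ k, hk, hCells C k⟩)
    hDoor hR h₂₁ h₂₂

/-- **`HC_AV` from LOCAL regime 2 at the cells `(6k, 3k)`, `k ≥ 1`, alone** (with the five other binders) — FACT-FREE: the rung `(6, 3)`
(`k = 1`, the only cell with print contact) and its «multiples» suffice; the cells `(4, 2)`, `(8, 4)`, `(10, 5)`, … with `3 ∤ m` are not
needed. (Recorded for the planners: a line feeding the cells `(6k, 3k)` from the `(6, 3)` carriers — e.g. by external products on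
products of `k` anchors, modulo a product rule for door admissibility — would give the whole leaf; nothing of the kind is claimed here.)
[cite: Andre1996Motifs, §6.3 Lemmes 6.3.1–6.3.3] [cite: BrosnanFangNiePearlstein2009, §6 Lemma 48] [cite: Markman2025SecantWeil, Thm. 1.5.1] -/
theorem hc_av_of_twPrimeAtDiagLocal_cells_six_mul (hC : Theses.VHCAbelianSchemesRoad.ChernCharacterOnBetti)
    (hCells : ∀ (C : ChernCharacterBetti) (k : ℕ), 1 ≤ k →
      LefAtExceptionalRegimeAtLocal (twistedReflexiveClass C
        (fun n X₀ I E => Summit.Ventures.HSemireg.gluableSigmaAdmissible n X₀ I E ∨ bfSingleAdmissible' n X₀ I E)) (2 * (3 * k)) (3 * k))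
    (hDoor : Theses.VHCAbelianSchemesRoad.TwistedPerfectDoorPrime) (hR : Theses.VHCAbelianSchemesRoad.RaynaudSectionProjective)
    (h₂₁ : Theses.VHCAbelianSchemesRoad.AndreCMAnchoredPencil) (h₂₂ : Theses.VHCAbelianSchemesRoad.AndreAnchoredPencilsAlgebraic) :
    Theses.PadicSemiregularLift.HodgeAbelianVarieties :=
  hc_av_of_twPrimeAtDiagLocal_along hC (fun k => 3 * (k + 1)) (fun M => ⟨M, by omega⟩) (fun C k => hCells C (k + 1) (by omega))
    hDoor hR h₂₁ h₂₂

end Summit.HodgeConjecture.HodgeConjecture.Ring2.SemiregularRepresentatives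

end
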